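import Literature.Analysis.FluidPDE.BoltzmannEquationProofs
import HarnessLib

/-!
# Ukai–Lanford local well-posedness of the hard-sphere Boltzmann equation, I: velocity estimates

Helper file (theorems only) for the discharge of the named fact
`Literature.MathematicalPhysics.KineticTheory.ukai_lanford_lwp` (local well-posedness of the
hard-sphere Boltzmann equation on the torus in Lanford's Gaussian-weighted continuous class;
Gallagher–Saint-Raymond–Texier 2013 = GST, Part I Ch. 2 §3.1 Thm 1 and Part II Ch. 5; Ukai 2001).
This file contains the *velocity-space* half of the continuity estimates of GST 2013, Part II
Ch. 5 (Proposition "continuity estimates", there stated for the hierarchy operators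
`C_{s,s+1}`; here `s = 1`, the quadratic operator `Q(f, f)` of Wave0, hard-sphere kernel
`((v - v_*)·ω)_+`), in the crude pointwise form actually used in the existence proof
(GST 2013 Part II Ch. 5, remark after the Proposition: "In the existence proof, we use instead the
pointwise bound"):

* `abs_collisionIntegrand_sub_le`, `abs_collisionOp_sub_le`, `abs_collisionOp_le`: if
  `|f|, |g| ≤ M e^{-β|v|²/2}` and `|f - g| ≤ N e^{-β|v|²/2}` then
  `|Q(f,f)(v) - Q(g,g)(v)| ≤ 4 M N |S^{d-1}| I_β (1 + |v|) e^{-β|v|²/2}` with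
  `I_β = ∫ (1 + |u|) e^{-β|u|²/2} du` (conservation of energy makes the Gaussian a collision
  invariant; the factor `1 + |v|` is the hard-sphere loss of weight);
* `neg_collisionOp_add_mul_lossPos_le`: the one-sided bound behind positivity of solutions,
  `-(Q(f,f)(v) + f(v) L(f⁺)(v)) ≤ 3 M N |S^{d-1}| I_β (1 + |v|) e^{-β|v|²/2}` when moreover
  `-f ≤ N e^{-β|v|²/2}`, where `L(h)(v) = ∫∫ ((v-v_*)·ω)_+ h(v_*) dω dv_*`;
* `continuous_collisionOp_param`, `continuous_lossPos_param`: joint continuity of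
  `(p, v) ↦ Q(F_p, F_p)(v)` and `(p, v) ↦ L(F_p⁺)(v)` for a jointly continuous, Gaussian-dominated
  family `F` (parametric integrals: compact sphere, then dominated convergence in `v_*`);
* elementary Gaussian algebra (`mul_exp_neg_mul_sq_le`: `x e^{-a x²} ≤ 1/(2√a)`, the weight-loss
  inequality `(1 + x) e^{-δx²/2} ≤ 1 + (2δ)^{-1/2}`; monotonicity of `I_β`).

Everything is a theorem (no definitions, no named facts); constants are explicit. Velocity space:
a finite-dimensional real inner product space `E` (as in Wave0).

## References

* I. Gallagher, L. Saint-Raymond, B. Texier, *From Newton to Boltzmann: hard spheres and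
  short-range potentials*, ZLAM, EMS (2013), arXiv:1208.5753: Part I Ch. 2 §3.1 (Thm 1), Part II
  Ch. 5 §§1–3 (function spaces `X_{0,β}`, continuity estimates, Lemma "Ukai").
* S. Ukai, *The Boltzmann–Grad limit and Cauchy–Kovalevskaya theorem*, Japan J. Indust. Appl.
  Math. 18 (2001) 383–392.
-/

open MeasureTheory Metric Real Set Filter Topology
open scoped InnerProductSpace ENNReal

namespace Literature.MathematicalPhysics.KineticTheory

namespace UkaiLanford

noncomputable section

/-! ## Elementary Gaussian algebra -/

section Gaussian

/-- `x e^{-a x²} ≤ 1 / (2 √a)` for `a > 0` (from `2√a x ≤ 1 + a x² ≤ e^{a x²}`). [folklore] -/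
theorem mul_exp_neg_mul_sq_le {a : ℝ} (ha : 0 < a) (x : ℝ) :
    x * exp (-a * x ^ 2) ≤ 1 / (2 * sqrt a) := by
  have hs : 0 < sqrt a := sqrt_pos.2 ha
  have hsq : sqrt a ^ 2 = a := sq_sqrt ha.le
  have h1 : 2 * sqrt a * x ≤ 1 + a * x ^ 2 := by nlinarith [sq_nonneg (sqrt a * x - 1)]
  have h2 : 1 + a * x ^ 2 ≤ exp (a * x ^ 2) := by linarith [add_one_le_exp (a * x ^ 2)]
  have h3 : exp (-a * x ^ 2) = (exp (a * x ^ 2))⁻¹ := by rw [← Real.exp_neg]; ring_nf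
  rw [h3, le_div_iff₀ (by positivity)]
  calc x * (exp (a * x ^ 2))⁻¹ * (2 * sqrt a) = (2 * sqrt a * x) * (exp (a * x ^ 2))⁻¹ := by ring
    _ ≤ exp (a * x ^ 2) * (exp (a * x ^ 2))⁻¹ := by gcongr; exact h1.trans h2
    _ = 1 := mul_inv_cancel₀ (exp_pos _).ne'

/-- The loss-of-weight inequality: `(1 + x) e^{-δ x²/2} ≤ 1 + 1/√(2δ)` for `δ > 0`
(GST 2013 Part II Ch. 5, proof of the continuity estimate: `|v| e^{-γ|v|²/2} ≤ (eγ)^{-1/2}`). [cite: GST2013, Part II Ch. 5 §3] -/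
theorem one_add_mul_exp_le {δ : ℝ} (hδ : 0 < δ) (x : ℝ) :
    (1 + x) * exp (-(δ / 2) * x ^ 2) ≤ 1 + 1 / sqrt (2 * δ) := by
  have h1 : exp (-(δ / 2) * x ^ 2) ≤ 1 := by
    rw [exp_le_one_iff]; nlinarith [sq_nonneg x]
  have h2 := mul_exp_neg_mul_sq_le (half_pos hδ) x
  have h3 : 2 * sqrt (δ / 2) = sqrt (2 * δ) := by
    rw [show (2 : ℝ) * δ = 2 ^ 2 * (δ / 2) by ring, sqrt_mul (by norm_num) (δ / 2), sqrt_sq (by norm_num)]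
  rw [add_mul, one_mul, ← h3]
  exact add_le_add h1 h2

/-- Monotonicity of the Gaussian in the inverse temperature: `e^{-β'|u|²/2} ≤ e^{-β|u|²/2}` for
`β ≤ β'`. [folklore] -/
theorem exp_weight_mono {β β' : ℝ} (h : β ≤ β') (r : ℝ) :
    exp (-(β' / 2) * r ^ 2) ≤ exp (-(β / 2) * r ^ 2) := by
  rw [exp_le_exp]; nlinarith [sq_nonneg r]

end Gaussian

/-! ## The hard-sphere kernel -/

section Kernel

variable {E : Type*} [NormedAddCommGroup E] [InnerProductSpace ℝ E]

/-- `((v - v_*)·ω)_+ ≥ 0`. [folklore] -/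
theorem hardSphereKernel_nonneg' (p : E × E) (ω : sphere (0 : E) 1) : 0 ≤ hardSphereKernel p ω :=
  le_max_right _ _

/-- `((v - v_*)·ω)_+ ≤ |v - v_*| ≤ (1 + |v|)(1 + |v_*|)`. [folklore] -/
theorem hardSphereKernel_le_weight (p : E × E) (ω : sphere (0 : E) 1) :
    hardSphereKernel p ω ≤ (1 + ‖p.1‖) * (1 + ‖p.2‖) := by
  have h1 : hardSphereKernel p ω ≤ ‖p.1 - p.2‖ := by
    refine max_le ?_ (norm_nonneg _)
    calc ⟪p.1 - p.2, (ω : E)⟫_ℝ ≤ ‖p.1 - p.2‖ * ‖(ω : E)‖ := real_inner_le_norm _ _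
      _ = ‖p.1 - p.2‖ := by rw [norm_eq_of_mem_sphere ω, mul_one]
  have h2 : ‖p.1 - p.2‖ ≤ ‖p.1‖ + ‖p.2‖ := norm_sub_le _ _
  nlinarith [norm_nonneg p.1, norm_nonneg p.2]

/-- The hard-sphere kernel is jointly continuous in `(v, v_*, ω)`. [folklore] -/
@[fun_prop]
theorem continuous_hardSphereKernel_uncurry :
    Continuous (fun q : (E × E) × sphere (0 : E) 1 => hardSphereKernel q.1 q.2) := by
  unfold hardSphereKernel; fun_prop

/-- The collision integrand of the zero density vanishes. [folklore] -/
@[simp]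
theorem collisionIntegrand_zero (p : E × E) (ω : sphere (0 : E) 1) :
    collisionIntegrand (0 : E → ℝ) 0 p ω = 0 := by
  simp [collisionIntegrand]

end Kernel

/-! ## Pointwise bounds on the collision integrand -/

section Pointwise

variable {E : Type*} [NormedAddCommGroup E] [InnerProductSpace ℝ E]

/-- Products of Gaussian-dominated functions: `|a b - a' b'| ≤ 2 M N e₁ e₂` when
`|a|, |a'| ≤ M e₁`-type bounds and `|a - a'| ≤ N e₁`-type bounds hold. [folklore] -/
theorem abs_mul_sub_mul_le {a b a' b' M N e₁ e₂ : ℝ} (he₁ : 0 ≤ e₁) (hN : 0 ≤ N)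
    (hb : |b| ≤ M * e₂) (ha' : |a'| ≤ M * e₁) (haa : |a - a'| ≤ N * e₁) (hbb : |b - b'| ≤ N * e₂) :
    |a * b - a' * b'| ≤ 2 * M * N * (e₁ * e₂) := by
  have hM : 0 ≤ M * e₂ := (abs_nonneg _).trans hb
  have h : a * b - a' * b' = (a - a') * b + a' * (b - b') := by ring
  rw [h]
  calc |(a - a') * b + a' * (b - b')| ≤ |(a - a') * b| + |a' * (b - b')| := abs_add_le _ _
    _ = |a - a'| * |b| + |a'| * |b - b'| := by rw [abs_mul, abs_mul]
    _ ≤ (N * e₁) * (M * e₂) + (M * e₁) * (N * e₂) :=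
        add_le_add (mul_le_mul haa hb (abs_nonneg _) (mul_nonneg hN he₁))
          (mul_le_mul ha' hbb (abs_nonneg _) ((abs_nonneg _).trans ha'))
    _ = 2 * M * N * (e₁ * e₂) := by ring

/-- **Pointwise continuity estimate for the hard-sphere collision integrand.** If
`|f|, |g| ≤ M e^{-β|u|²/2}` and `|f - g| ≤ N e^{-β|u|²/2}`, then
`|B (f'f'_* - f f_*) - B (g'g'_* - g g_*)| ≤ 4 M N ψ(v) ψ(v_*)`, `ψ(u) = (1 + |u|) e^{-β|u|²/2}`
(conservation of energy, `Literature.Analysis.FluidPDE.exp_collide_mul_exp_collide`, and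
`((v - v_*)·ω)_+ ≤ (1 + |v|)(1 + |v_*|)`; GST 2013 Part II Ch. 5 §3). [cite: GST2013, Part II Ch. 5 §3] -/
theorem abs_collisionIntegrand_sub_le {f g : E → ℝ} {M N β : ℝ} (hN : 0 ≤ N)
    (hf : ∀ u, |f u| ≤ M * exp (-(β / 2) * ‖u‖ ^ 2))
    (hg : ∀ u, |g u| ≤ M * exp (-(β / 2) * ‖u‖ ^ 2))
    (hfg : ∀ u, |f u - g u| ≤ N * exp (-(β / 2) * ‖u‖ ^ 2))
    (p : E × E) (ω : sphere (0 : E) 1) :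
    |collisionIntegrand f f p ω - collisionIntegrand g g p ω| ≤
      4 * M * N * (((1 + ‖p.1‖) * exp (-(β / 2) * ‖p.1‖ ^ 2)) *
        ((1 + ‖p.2‖) * exp (-(β / 2) * ‖p.2‖ ^ 2))) := by
  set p' := collide ω p with hp'
  have hen : exp (-(β / 2) * ‖p'.1‖ ^ 2) * exp (-(β / 2) * ‖p'.2‖ ^ 2) =
      exp (-(β / 2) * ‖p.1‖ ^ 2) * exp (-(β / 2) * ‖p.2‖ ^ 2) :=
    Literature.Analysis.FluidPDE.exp_collide_mul_exp_collide β ω p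
  have hgain : |f p'.1 * f p'.2 - g p'.1 * g p'.2| ≤
      2 * M * N * (exp (-(β / 2) * ‖p.1‖ ^ 2) * exp (-(β / 2) * ‖p.2‖ ^ 2)) := by
    rw [← hen]
    exact abs_mul_sub_mul_le (exp_pos _).le hN (hf _) (hg _) (hfg _) (hfg _)
  have hloss : |f p.1 * f p.2 - g p.1 * g p.2| ≤
      2 * M * N * (exp (-(β / 2) * ‖p.1‖ ^ 2) * exp (-(β / 2) * ‖p.2‖ ^ 2)) :=
    abs_mul_sub_mul_le (exp_pos _).le hN (hf _) (hg _) (hfg _) (hfg _)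
  have hk0 : 0 ≤ hardSphereKernel p ω := hardSphereKernel_nonneg' p ω
  have hk := hardSphereKernel_le_weight p ω
  have hMN : 0 ≤ 2 * M * N * (exp (-(β / 2) * ‖p.1‖ ^ 2) * exp (-(β / 2) * ‖p.2‖ ^ 2)) :=
    (abs_nonneg _).trans hloss
  have h : collisionIntegrand f f p ω - collisionIntegrand g g p ω =
      hardSphereKernel p ω * ((f p'.1 * f p'.2 - g p'.1 * g p'.2) - (f p.1 * f p.2 - g p.1 * g p.2)) := by
    simp only [collisionIntegrand, hp']; ring
  rw [h, abs_mul, abs_of_nonneg hk0]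
  calc hardSphereKernel p ω * |(f p'.1 * f p'.2 - g p'.1 * g p'.2) - (f p.1 * f p.2 - g p.1 * g p.2)|
      ≤ ((1 + ‖p.1‖) * (1 + ‖p.2‖)) *
          (2 * M * N * (exp (-(β / 2) * ‖p.1‖ ^ 2) * exp (-(β / 2) * ‖p.2‖ ^ 2)) +
            2 * M * N * (exp (-(β / 2) * ‖p.1‖ ^ 2) * exp (-(β / 2) * ‖p.2‖ ^ 2))) :=
        mul_le_mul hk ((abs_sub _ _).trans (add_le_add hgain hloss)) (abs_nonneg _) (by positivity)
    _ = _ := by ring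

/-- The special case `g = 0`: `|B (f'f'_* - f f_*)| ≤ 4 M² ψ(v) ψ(v_*)`. [folklore] -/
theorem abs_collisionIntegrand_le {f : E → ℝ} {M β : ℝ} (hM : 0 ≤ M)
    (hf : ∀ u, |f u| ≤ M * exp (-(β / 2) * ‖u‖ ^ 2)) (p : E × E) (ω : sphere (0 : E) 1) :
    |collisionIntegrand f f p ω| ≤
      4 * M * M * (((1 + ‖p.1‖) * exp (-(β / 2) * ‖p.1‖ ^ 2)) *
        ((1 + ‖p.2‖) * exp (-(β / 2) * ‖p.2‖ ^ 2))) := by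
  have h := abs_collisionIntegrand_sub_le (f := f) (g := 0) (M := M) (N := M) (β := β) hM hf
    (fun u => by
      have h0 := mul_nonneg hM (exp_pos (-(β / 2) * ‖u‖ ^ 2)).le
      simpa using h0)
    (fun u => by simpa using hf u) p ω
  simpa using h

/-- Sign bookkeeping for positivity: if `|a| ≤ M e₁`, `-a ≤ N e₁`, `|b| ≤ M e₂`, `-b ≤ N e₂`
(`M, N, e₁, e₂ ≥ 0`) then `a b ≥ -2 M N e₁ e₂` (indeed `≥ -M N e₁ e₂`; case analysis on the signs).
[folklore] -/
theorem mul_ge_neg_of_bounds {a b M N e₁ e₂ : ℝ} (hN : 0 ≤ N) (he₁ : 0 ≤ e₁) (he₂ : 0 ≤ e₂)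
    (ha : |a| ≤ M * e₁) (hna : -a ≤ N * e₁) (hb : |b| ≤ M * e₂) (hnb : -b ≤ N * e₂) :
    -(M * N * (e₁ * e₂)) ≤ a * b := by
  have hMe₁ : 0 ≤ M * e₁ := (abs_nonneg _).trans ha
  have hNe₁ : 0 ≤ N * e₁ := mul_nonneg hN he₁
  have hNe₂ : 0 ≤ N * e₂ := mul_nonneg hN he₂
  rcases le_or_gt 0 a with ha0 | ha0
  · have h1 : a * (-(N * e₂)) ≤ a * b := mul_le_mul_of_nonneg_left (neg_le.1 hnb) ha0
    have h2 : a * (N * e₂) ≤ (M * e₁) * (N * e₂) :=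
      mul_le_mul_of_nonneg_right ((le_abs_self a).trans ha) hNe₂
    calc -(M * N * (e₁ * e₂)) = -((M * e₁) * (N * e₂)) := by ring
      _ ≤ -(a * (N * e₂)) := neg_le_neg h2
      _ = a * (-(N * e₂)) := by ring
      _ ≤ a * b := h1
  · rcases le_or_gt 0 b with hb0 | hb0
    · have h1 : (-(N * e₁)) * b ≤ a * b := mul_le_mul_of_nonneg_right (neg_le.1 hna) hb0
      have h2 : (N * e₁) * b ≤ (N * e₁) * (M * e₂) :=
        mul_le_mul_of_nonneg_left ((le_abs_self b).trans hb) hNe₁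
      calc -(M * N * (e₁ * e₂)) = -((N * e₁) * (M * e₂)) := by ring
        _ ≤ -((N * e₁) * b) := neg_le_neg h2
        _ = (-(N * e₁)) * b := by ring
        _ ≤ a * b := h1
    · have h1 : 0 ≤ a * b := (mul_pos_of_neg_of_neg ha0 hb0).le
      have h2 : 0 ≤ M * N * (e₁ * e₂) :=
        calc (0 : ℝ) ≤ (M * e₁) * (N * e₂) := mul_nonneg hMe₁ hNe₂
          _ = M * N * (e₁ * e₂) := by ring
      linarith

/-- **Pointwise positivity source bound.** If `|f| ≤ M e^{-β|u|²/2}` and `-f ≤ N e^{-β|u|²/2}`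
(`M, N ≥ 0`), then for the hard-sphere integrand
`B (f' f'_* - f f_*) + f(v) B (f_*)⁺ = B (f' f'_* + f(v) (f_*)⁻) ≥ -3 M N ψ(v) ψ(v_*)`. This is the
inequality that makes the gain term plus the `f⁺`-absorption nonnegative up to a term linear in
the negative part (Kaniel–Shinbrot-type sign structure of `Q = Q⁺ - f L(f)`). [folklore] -/
theorem neg_collisionIntegrand_add_mul_le {f : E → ℝ} {M N β : ℝ} (hM : 0 ≤ M) (hN : 0 ≤ N)
    (hf : ∀ u, |f u| ≤ M * exp (-(β / 2) * ‖u‖ ^ 2))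
    (hfn : ∀ u, -f u ≤ N * exp (-(β / 2) * ‖u‖ ^ 2))
    (p : E × E) (ω : sphere (0 : E) 1) :
    -(3 * M * N * (((1 + ‖p.1‖) * exp (-(β / 2) * ‖p.1‖ ^ 2)) *
        ((1 + ‖p.2‖) * exp (-(β / 2) * ‖p.2‖ ^ 2)))) ≤
      collisionIntegrand f f p ω + f p.1 * (hardSphereKernel p ω * max (f p.2) 0) := by
  set p' := collide ω p with hp'
  set e : E → ℝ := fun u => exp (-(β / 2) * ‖u‖ ^ 2) with he
  have he0 : ∀ u, 0 ≤ e u := fun u => (exp_pos _).le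
  have hen : e p'.1 * e p'.2 = e p.1 * e p.2 :=
    Literature.Analysis.FluidPDE.exp_collide_mul_exp_collide β ω p
  -- gain part: `f' f'_* ≥ -M N e e ≥ -2 M N e(v) e(v_*)`
  have hgain : -(M * N * (e p.1 * e p.2)) ≤ f p'.1 * f p'.2 := by
    rw [← hen]
    exact mul_ge_neg_of_bounds hN (he0 _) (he0 _) (hf _) (hfn _) (hf _) (hfn _)
  -- absorption part: `f(v) (f_*)⁻ ≥ -N e(v) M e(v_*)`
  have hneg_nonneg : 0 ≤ max (f p.2) 0 - f p.2 := by
    rcases le_total (f p.2) 0 with h | h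
    · rw [max_eq_right h]; linarith
    · rw [max_eq_left h]; simp
  have hneg_le : max (f p.2) 0 - f p.2 ≤ M * e p.2 := by
    rcases le_total (f p.2) 0 with h | h
    · rw [max_eq_right h, zero_sub]; exact (neg_le_abs _).trans (hf _)
    · rw [max_eq_left h, sub_self]; exact mul_nonneg hM (he0 _)
  have habs : -(N * M * (e p.1 * e p.2)) ≤ f p.1 * (max (f p.2) 0 - f p.2) := by
    have h1 : -(N * e p.1) * (max (f p.2) 0 - f p.2) ≤ f p.1 * (max (f p.2) 0 - f p.2) :=
      mul_le_mul_of_nonneg_right (by linarith [hfn p.1]) hneg_nonneg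
    have h2 : (N * e p.1) * (max (f p.2) 0 - f p.2) ≤ (N * e p.1) * (M * e p.2) :=
      mul_le_mul_of_nonneg_left hneg_le (mul_nonneg hN (he0 _))
    nlinarith
  have hk0 : 0 ≤ hardSphereKernel p ω := hardSphereKernel_nonneg' p ω
  have hk := hardSphereKernel_le_weight p ω
  have hsum : -(3 * M * N * (e p.1 * e p.2)) ≤ f p'.1 * f p'.2 + f p.1 * (max (f p.2) 0 - f p.2) := by
    nlinarith [mul_nonneg (mul_nonneg hM hN) (mul_nonneg (he0 p.1) (he0 p.2))]
  have hid : collisionIntegrand f f p ω + f p.1 * (hardSphereKernel p ω * max (f p.2) 0) =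
      hardSphereKernel p ω * (f p'.1 * f p'.2 + f p.1 * (max (f p.2) 0 - f p.2)) := by
    simp only [collisionIntegrand, hp']; ring
  rw [hid]
  have h3 : 0 ≤ 3 * M * N * (e p.1 * e p.2) := by
    have := mul_nonneg (mul_nonneg hM hN) (mul_nonneg (he0 p.1) (he0 p.2)); nlinarith
  calc -(3 * M * N * (((1 + ‖p.1‖) * e p.1) * ((1 + ‖p.2‖) * e p.2)))
      = ((1 + ‖p.1‖) * (1 + ‖p.2‖)) * (-(3 * M * N * (e p.1 * e p.2))) := by ring
    _ ≤ hardSphereKernel p ω * (-(3 * M * N * (e p.1 * e p.2))) :=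
        mul_le_mul_of_nonpos_right hk (by linarith)
    _ ≤ hardSphereKernel p ω * (f p'.1 * f p'.2 + f p.1 * (max (f p.2) 0 - f p.2)) :=
        mul_le_mul_of_nonneg_left hsum hk0

end Pointwise

/-! ## Parametric integrals over the sphere and over velocity space -/

section Velocity

variable {E : Type*} [NormedAddCommGroup E] [InnerProductSpace ℝ E] [FiniteDimensional ℝ E]
  [MeasurableSpace E] [BorelSpace E]

/-- A continuous family of continuous functions on the (compact) unit sphere has a continuous
sphere integral (Mathlib's `continuous_parametric_integral_of_continuous`). [folklore] -/
theorem continuous_integral_sphere {P : Type*} [TopologicalSpace P] [FirstCountableTopology P]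
    [LocallyCompactSpace P] {H : P → sphere (0 : E) 1 → ℝ} (hH : Continuous (Function.uncurry H)) :
    Continuous (fun q => ∫ ω, H q ω ∂(sphereMeasure : Measure (sphere (0 : E) 1))) := by
  haveI := Literature.Analysis.FluidPDE.isFiniteMeasure_sphereMeasure (E := E)
  have h := continuous_parametric_integral_of_continuous
    (μ := (sphereMeasure : Measure (sphere (0 : E) 1))) hH isCompact_univ
  simpa only [Measure.restrict_univ] using h

/-- The slices `H(v_*, ·)` of a jointly continuous `H` are integrable on the (compact, finite
measure) unit sphere. [folklore] -/
theorem integrable_sphere_slice {H : E → sphere (0 : E) 1 → ℝ} (hH : Continuous (Function.uncurry H))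
    (w : E) : Integrable (H w) (sphereMeasure : Measure (sphere (0 : E) 1)) := by
  haveI := Literature.Analysis.FluidPDE.isFiniteMeasure_sphereMeasure (E := E)
  have hw : Continuous (H w) := hH.comp (Continuous.prodMk_right w)
  exact hw.integrable_of_hasCompactSupport (isClosed_tsupport _).isCompact

/-- The sphere integral of a dominated integrand: `|∫ H dω| ≤ |S^{d-1}| C` if `|H| ≤ C`. [folklore] -/
theorem norm_integral_sphere_le {H : sphere (0 : E) 1 → ℝ} {C : ℝ} (hC : ∀ ω, |H ω| ≤ C) :
    ‖∫ ω, H ω ∂(sphereMeasure : Measure (sphere (0 : E) 1))‖ ≤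
      (sphereMeasure : Measure (sphere (0 : E) 1)).real univ * C := by
  haveI := Literature.Analysis.FluidPDE.isFiniteMeasure_sphereMeasure (E := E)
  calc ‖∫ ω, H ω ∂(sphereMeasure : Measure (sphere (0 : E) 1))‖
      ≤ ∫ ω, ‖H ω‖ ∂(sphereMeasure : Measure (sphere (0 : E) 1)) := norm_integral_le_integral_norm _
    _ ≤ ∫ _ω, C ∂(sphereMeasure : Measure (sphere (0 : E) 1)) :=
        integral_mono_of_nonneg (Eventually.of_forall fun _ => norm_nonneg _) (integrable_const _)
          (Eventually.of_forall fun ω => by dsimp only; rw [Real.norm_eq_abs]; exact hC ω)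
    _ = (sphereMeasure : Measure (sphere (0 : E) 1)).real univ * C := by
        rw [integral_const, smul_eq_mul]

/-- **Continuity of doubly parametric collision-type integrals.** If `H(q, v_*, ω)` is jointly
continuous and `|H(q, v_*, ω)| ≤ c(q) Ψ(v_*)` with `c` continuous and `Ψ ≥ 0` integrable, then
`q ↦ ∫ (∫ H(q, v_*, ω) dω) dv_*` is continuous (compactness of the sphere for the inner integral,
dominated convergence for the outer one). [folklore] -/
theorem continuous_integral_integral_sphere {P : Type*} [TopologicalSpace P]
    [FirstCountableTopology P] [LocallyCompactSpace P] {H : P → E → sphere (0 : E) 1 → ℝ}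
    (hH : Continuous (fun z : (P × E) × sphere (0 : E) 1 => H z.1.1 z.1.2 z.2))
    {c : P → ℝ} (hc : Continuous c) {Ψ : E → ℝ} (hΨ : Integrable Ψ) (hΨ0 : ∀ w, 0 ≤ Ψ w)
    (hdom : ∀ q w ω, |H q w ω| ≤ c q * Ψ w) :
    Continuous (fun q => ∫ w, ∫ ω, H q w ω ∂(sphereMeasure : Measure (sphere (0 : E) 1))) := by
  set S : ℝ := (sphereMeasure : Measure (sphere (0 : E) 1)).real univ with hS
  have hin : Continuous (fun z : P × E => ∫ ω, H z.1 z.2 ω ∂(sphereMeasure : Measure (sphere (0 : E) 1))) :=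
    continuous_integral_sphere (P := P × E) (H := fun z ω => H z.1 z.2 ω) hH
  have hbd : ∀ q w, ‖∫ ω, H q w ω ∂(sphereMeasure : Measure (sphere (0 : E) 1))‖ ≤ S * (c q * Ψ w) :=
    fun q w => norm_integral_sphere_le (hdom q w)
  rw [continuous_iff_continuousAt]
  intro q₀
  have hev : ∀ᶠ q in 𝓝 q₀, c q < c q₀ + 1 :=
    hc.continuousAt.eventually_lt continuousAt_const (by linarith)
  refine continuousAt_of_dominated (bound := fun w => S * ((c q₀ + 1) * Ψ w)) ?_ ?_ ?_ ?_
  · exact Eventually.of_forall fun q =>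
      (hin.comp (Continuous.prodMk_right q)).aestronglyMeasurable
  · filter_upwards [hev] with q hq
    refine Eventually.of_forall fun w => (hbd q w).trans ?_
    have hS0 : 0 ≤ S := measureReal_nonneg
    exact mul_le_mul_of_nonneg_left (mul_le_mul_of_nonneg_right hq.le (hΨ0 w)) hS0
  · exact (hΨ.const_mul _).const_mul _
  · exact Eventually.of_forall fun w => (hin.comp (Continuous.prodMk_left w)).continuousAt

/-- Integrability in `v_*` of a sphere integral dominated by `C Ψ(v_*)`, `Ψ` integrable. [folklore] -/
theorem integrable_integral_sphere {H : E → sphere (0 : E) 1 → ℝ}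
    (hH : Continuous (Function.uncurry H)) {C : ℝ} {Ψ : E → ℝ} (hΨ : Integrable Ψ)
    (hdom : ∀ w ω, |H w ω| ≤ C * Ψ w) :
    Integrable (fun w => ∫ ω, H w ω ∂(sphereMeasure : Measure (sphere (0 : E) 1))) := by
  refine Integrable.mono' ((hΨ.const_mul C).const_mul ((sphereMeasure : Measure (sphere (0 : E) 1)).real univ))
    (continuous_integral_sphere hH).aestronglyMeasurable (Eventually.of_forall fun w => ?_)
  exact norm_integral_sphere_le (hdom w)

/-! ## The collision operator in Lanford's weighted class -/

omit [FiniteDimensional ℝ E] [MeasurableSpace E] [BorelSpace E] in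
/-- The hard-sphere collision integrand of continuous densities is jointly continuous. [folklore] -/
theorem continuous_collisionIntegrand {f g : E → ℝ} (hf : Continuous f) (hg : Continuous g) :
    Continuous (fun q : (E × E) × sphere (0 : E) 1 => collisionIntegrand f g q.1 q.2) := by
  unfold collisionIntegrand
  have hc := Literature.Analysis.FluidPDE.continuous_collide_uncurry (E := E)
  have h1 : Continuous (fun q : (E × E) × sphere (0 : E) 1 => f (collide q.2 q.1).1) :=
    hf.comp (continuous_fst.comp hc)
  have h2 : Continuous (fun q : (E × E) × sphere (0 : E) 1 => g (collide q.2 q.1).2) :=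
    hg.comp (continuous_snd.comp hc)
  have h3 : Continuous (fun q : (E × E) × sphere (0 : E) 1 => f q.1.1) := hf.comp (by fun_prop)
  have h4 : Continuous (fun q : (E × E) × sphere (0 : E) 1 => g q.1.2) := hg.comp (by fun_prop)
  exact continuous_hardSphereKernel_uncurry.mul ((h1.mul h2).sub (h3.mul h4))

/-- **Continuity estimate with loss for the hard-sphere collision operator, difference form**
(GST 2013 Part II Ch. 5 §3, `s = 1`): for continuous `f, g` with `|f|, |g| ≤ M e^{-β|u|²/2}`,
`|f - g| ≤ N e^{-β|u|²/2}`, `β > 0`,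
`|Q(f,f)(v) - Q(g,g)(v)| ≤ 4 M N |S^{d-1}| I_β (1 + |v|) e^{-β|v|²/2}`,
`I_β = ∫ (1 + |u|) e^{-β|u|²/2} du`. [cite: GST2013, Part II Ch. 5 §3] -/
theorem abs_collisionOp_sub_le {f g : E → ℝ} (hfc : Continuous f) (hgc : Continuous g) {M N β : ℝ}
    (hM : 0 ≤ M) (hN : 0 ≤ N) (hβ : 0 < β)
    (hf : ∀ u, |f u| ≤ M * exp (-(β / 2) * ‖u‖ ^ 2))
    (hg : ∀ u, |g u| ≤ M * exp (-(β / 2) * ‖u‖ ^ 2))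
    (hfg : ∀ u, |f u - g u| ≤ N * exp (-(β / 2) * ‖u‖ ^ 2)) (v : E) :
    |collisionOp f f v - collisionOp g g v| ≤
      4 * M * N * (sphereMeasure : Measure (sphere (0 : E) 1)).real univ *
        (∫ u : E, (1 + ‖u‖) * exp (-(β / 2) * ‖u‖ ^ 2)) *
          ((1 + ‖v‖) * exp (-(β / 2) * ‖v‖ ^ 2)) := by
  set S : ℝ := (sphereMeasure : Measure (sphere (0 : E) 1)).real univ with hS
  set ψ : E → ℝ := fun u => (1 + ‖u‖) * exp (-(β / 2) * ‖u‖ ^ 2) with hψ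
  have hψi : Integrable ψ := Literature.Analysis.FluidPDE.integrable_one_add_norm_mul_exp hβ
  have hψ0 : ∀ u, 0 ≤ ψ u := fun u => by positivity
  -- pointwise bounds on the integrands
  have hdf : ∀ w ω, |collisionIntegrand f f (v, w) ω| ≤ (4 * M * M * ψ v) * ψ w := fun w ω => by
    have h := abs_collisionIntegrand_le hM hf (v, w) ω
    simp only [hψ]; dsimp only at h; linarith
  have hdg : ∀ w ω, |collisionIntegrand g g (v, w) ω| ≤ (4 * M * M * ψ v) * ψ w := fun w ω => by
    have h := abs_collisionIntegrand_le hM hg (v, w) ω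
    simp only [hψ]; dsimp only at h; linarith
  have hdfg : ∀ w ω, |collisionIntegrand f f (v, w) ω - collisionIntegrand g g (v, w) ω| ≤
      (4 * M * N * ψ v) * ψ w := fun w ω => by
    have h := abs_collisionIntegrand_sub_le hN hf hg hfg (v, w) ω
    simp only [hψ]; dsimp only at h; linarith
  -- integrability
  have hcf := continuous_collisionIntegrand hfc hfc
  have hcg := continuous_collisionIntegrand hgc hgc
  have hpw : Continuous fun q : E × sphere (0 : E) 1 => ((v, q.1), q.2) := by fun_prop
  have hcf' : Continuous (Function.uncurry fun w ω => collisionIntegrand f f (v, w) ω) := hcf.comp hpw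
  have hcg' : Continuous (Function.uncurry fun w ω => collisionIntegrand g g (v, w) ω) := hcg.comp hpw
  have hIf : Integrable (fun w => ∫ ω, collisionIntegrand f f (v, w) ω
      ∂(sphereMeasure : Measure (sphere (0 : E) 1))) :=
    integrable_integral_sphere (H := fun w ω => collisionIntegrand f f (v, w) ω) hcf' hψi hdf
  have hIg : Integrable (fun w => ∫ ω, collisionIntegrand g g (v, w) ω
      ∂(sphereMeasure : Measure (sphere (0 : E) 1))) :=
    integrable_integral_sphere (H := fun w ω => collisionIntegrand g g (v, w) ω) hcg' hψi hdg
  have hsf : ∀ w, Integrable (fun ω => collisionIntegrand f f (v, w) ω)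
      (sphereMeasure : Measure (sphere (0 : E) 1)) := fun w => integrable_sphere_slice hcf' w
  have hsg : ∀ w, Integrable (fun ω => collisionIntegrand g g (v, w) ω)
      (sphereMeasure : Measure (sphere (0 : E) 1)) := fun w => integrable_sphere_slice hcg' w
  -- the difference as one integral
  have hdiff : collisionOp f f v - collisionOp g g v =
      ∫ w, ((∫ ω, collisionIntegrand f f (v, w) ω ∂(sphereMeasure : Measure (sphere (0 : E) 1))) -
        ∫ ω, collisionIntegrand g g (v, w) ω ∂(sphereMeasure : Measure (sphere (0 : E) 1))) := by
    rw [collisionOp, collisionOp, ← integral_sub hIf hIg]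
  have hinner : ∀ w, ‖(∫ ω, collisionIntegrand f f (v, w) ω ∂(sphereMeasure : Measure (sphere (0 : E) 1))) -
      ∫ ω, collisionIntegrand g g (v, w) ω ∂(sphereMeasure : Measure (sphere (0 : E) 1))‖ ≤
        S * ((4 * M * N * ψ v) * ψ w) := by
    intro w
    rw [← integral_sub (hsf w) (hsg w)]
    exact norm_integral_sphere_le (hdfg w)
  rw [← Real.norm_eq_abs, hdiff]
  calc ‖∫ w, ((∫ ω, collisionIntegrand f f (v, w) ω ∂(sphereMeasure : Measure (sphere (0 : E) 1))) -
        ∫ ω, collisionIntegrand g g (v, w) ω ∂(sphereMeasure : Measure (sphere (0 : E) 1)))‖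
      ≤ ∫ w, S * ((4 * M * N * ψ v) * ψ w) :=
        norm_integral_le_of_norm_le ((hψi.const_mul _).const_mul _) (Eventually.of_forall hinner)
    _ = 4 * M * N * S * (∫ u, ψ u) * ψ v := by
        rw [integral_const_mul, integral_const_mul]; ring

/-- **Continuity estimate with loss for the hard-sphere collision operator** (GST 2013 Part II
Ch. 5 §3, `s = 1`): for continuous `f` with `|f| ≤ M e^{-β|u|²/2}`, `β > 0`,
`|Q(f,f)(v)| ≤ 4 M² |S^{d-1}| I_β (1 + |v|) e^{-β|v|²/2}`. [cite: GST2013, Part II Ch. 5 §3] -/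
theorem abs_collisionOp_le {f : E → ℝ} (hfc : Continuous f) {M β : ℝ} (hM : 0 ≤ M) (hβ : 0 < β)
    (hf : ∀ u, |f u| ≤ M * exp (-(β / 2) * ‖u‖ ^ 2)) (v : E) :
    |collisionOp f f v| ≤
      4 * M * M * (sphereMeasure : Measure (sphere (0 : E) 1)).real univ *
        (∫ u : E, (1 + ‖u‖) * exp (-(β / 2) * ‖u‖ ^ 2)) *
          ((1 + ‖v‖) * exp (-(β / 2) * ‖v‖ ^ 2)) := by
  have h0 : collisionOp (0 : E → ℝ) 0 v = 0 := by simp [collisionOp]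
  have h := abs_collisionOp_sub_le hfc continuous_const (g := 0) hM hM hβ hf
    (fun u => by
      have h0 := mul_nonneg hM (exp_pos (-(β / 2) * ‖u‖ ^ 2)).le
      simpa using h0)
    (fun u => by simpa using hf u) v
  rwa [h0, sub_zero] at h

/-- **Joint continuity of the collision term of a continuous Gaussian-dominated family**: if
`(p, u) ↦ F_p(u)` is continuous and `|F_p| ≤ M e^{-β|u|²/2}` (`β > 0`), then
`(p, v) ↦ Q(F_p, F_p)(v)` is continuous. [folklore] -/
theorem continuous_collisionOp_param {P : Type*} [TopologicalSpace P] [FirstCountableTopology P]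
    [LocallyCompactSpace P] {F : P → E → ℝ} (hF : Continuous (fun z : P × E => F z.1 z.2))
    {M β : ℝ} (hM : 0 ≤ M) (hβ : 0 < β) (hb : ∀ p u, |F p u| ≤ M * exp (-(β / 2) * ‖u‖ ^ 2)) :
    Continuous (fun z : P × E => collisionOp (F z.1) (F z.1) z.2) := by
  set ψ : E → ℝ := fun u => (1 + ‖u‖) * exp (-(β / 2) * ‖u‖ ^ 2) with hψ
  have hψi : Integrable ψ := Literature.Analysis.FluidPDE.integrable_one_add_norm_mul_exp hβ
  have hψc : Continuous ψ := by rw [hψ]; fun_prop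
  have hc := Literature.Analysis.FluidPDE.continuous_collide_uncurry (E := E)
  -- joint continuity of the integrand `((p, v), w, ω) ↦ collisionIntegrand (F p) (F p) (v, w) ω`
  have hH : Continuous (fun z : ((P × E) × E) × sphere (0 : E) 1 =>
      collisionIntegrand (F z.1.1.1) (F z.1.1.1) (z.1.1.2, z.1.2) z.2) := by
    unfold collisionIntegrand
    have hpair : Continuous (fun z : ((P × E) × E) × sphere (0 : E) 1 =>
        ((z.1.1.2, z.1.2), z.2)) := by fun_prop
    have hcol : Continuous (fun z : ((P × E) × E) × sphere (0 : E) 1 =>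
        collide z.2 (z.1.1.2, z.1.2)) := hc.comp hpair
    have h1 : Continuous (fun z : ((P × E) × E) × sphere (0 : E) 1 =>
        F z.1.1.1 (collide z.2 (z.1.1.2, z.1.2)).1) :=
      hF.comp ((by fun_prop : Continuous fun z : ((P × E) × E) × sphere (0 : E) 1 => z.1.1.1).prodMk
        (continuous_fst.comp hcol))
    have h2 : Continuous (fun z : ((P × E) × E) × sphere (0 : E) 1 =>
        F z.1.1.1 (collide z.2 (z.1.1.2, z.1.2)).2) :=
      hF.comp ((by fun_prop : Continuous fun z : ((P × E) × E) × sphere (0 : E) 1 => z.1.1.1).prodMk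
        (continuous_snd.comp hcol))
    have h3 : Continuous (fun z : ((P × E) × E) × sphere (0 : E) 1 => F z.1.1.1 z.1.1.2) :=
      hF.comp (by fun_prop : Continuous fun z : ((P × E) × E) × sphere (0 : E) 1 => (z.1.1.1, z.1.1.2))
    have h4 : Continuous (fun z : ((P × E) × E) × sphere (0 : E) 1 => F z.1.1.1 z.1.2) :=
      hF.comp (by fun_prop : Continuous fun z : ((P × E) × E) × sphere (0 : E) 1 => (z.1.1.1, z.1.2))
    exact (continuous_hardSphereKernel_uncurry.comp hpair).mul ((h1.mul h2).sub (h3.mul h4))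
  have hcq : Continuous (fun q : P × E => 4 * M * M * ψ q.2) := by fun_prop
  refine continuous_integral_integral_sphere
    (H := fun q w ω => collisionIntegrand (F q.1) (F q.1) (q.2, w) ω)
    hH hcq hψi (fun w => by positivity) (fun q w ω => ?_)
  have h := abs_collisionIntegrand_le hM (hb q.1) (q.2, w) ω
  simp only [hψ]; dsimp only at h; linarith

/-- **Joint continuity of the `f⁺`-collision frequency of a continuous Gaussian-dominated family**:
`(p, v) ↦ L(F_p⁺)(v) = ∫∫ ((v - v_*)·ω)_+ F_p(v_*)⁺ dω dv_*` is continuous. [folklore] -/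
theorem continuous_lossPos_param {P : Type*} [TopologicalSpace P] [FirstCountableTopology P]
    [LocallyCompactSpace P] {F : P → E → ℝ} (hF : Continuous (fun z : P × E => F z.1 z.2))
    {M β : ℝ} (hM : 0 ≤ M) (hβ : 0 < β) (hb : ∀ p u, |F p u| ≤ M * exp (-(β / 2) * ‖u‖ ^ 2)) :
    Continuous (fun z : P × E =>
      ∫ w, ∫ ω, hardSphereKernel (z.2, w) ω * max (F z.1 w) 0 ∂(sphereMeasure : Measure (sphere (0 : E) 1))) := by
  set ψ : E → ℝ := fun u => (1 + ‖u‖) * exp (-(β / 2) * ‖u‖ ^ 2) with hψ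
  have hψi : Integrable ψ := Literature.Analysis.FluidPDE.integrable_one_add_norm_mul_exp hβ
  have hH : Continuous (fun z : ((P × E) × E) × sphere (0 : E) 1 =>
      hardSphereKernel (z.1.1.2, z.1.2) z.2 * max (F z.1.1.1 z.1.2) 0) := by
    have hpair : Continuous (fun z : ((P × E) × E) × sphere (0 : E) 1 =>
        ((z.1.1.2, z.1.2), z.2)) := by fun_prop
    have h4 : Continuous (fun z : ((P × E) × E) × sphere (0 : E) 1 => F z.1.1.1 z.1.2) :=
      hF.comp (by fun_prop : Continuous fun z : ((P × E) × E) × sphere (0 : E) 1 => (z.1.1.1, z.1.2))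
    exact (continuous_hardSphereKernel_uncurry.comp hpair).mul (h4.max continuous_const)
  have hcq : Continuous (fun q : P × E => M * (1 + ‖q.2‖)) := by fun_prop
  refine continuous_integral_integral_sphere
    (H := fun q w ω => hardSphereKernel (q.2, w) ω * max (F q.1 w) 0)
    hH hcq hψi (fun w => by positivity) (fun q w ω => ?_)
  have hk0 := hardSphereKernel_nonneg' (q.2, w) ω
  have hk := hardSphereKernel_le_weight (q.2, w) ω
  have hm0 : 0 ≤ max (F q.1 w) 0 := le_max_right _ _
  have hm : max (F q.1 w) 0 ≤ M * exp (-(β / 2) * ‖w‖ ^ 2) :=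
    max_le ((le_abs_self _).trans (hb q.1 w)) (mul_nonneg hM (exp_pos _).le)
  rw [abs_of_nonneg (mul_nonneg hk0 hm0)]
  calc hardSphereKernel (q.2, w) ω * max (F q.1 w) 0
      ≤ ((1 + ‖q.2‖) * (1 + ‖w‖)) * (M * exp (-(β / 2) * ‖w‖ ^ 2)) := mul_le_mul hk hm hm0 (by positivity)
    _ = M * (1 + ‖q.2‖) * ψ w := by rw [hψ]; ring


/-- Monotonicity of the Gaussian moment `I_β = ∫ (1 + |u|) e^{-β|u|²/2} du` in `β`. [folklore] -/
theorem integral_one_add_norm_mul_exp_mono {β β' : ℝ} (hβ : 0 < β) (h : β ≤ β') :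
    ∫ u : E, (1 + ‖u‖) * exp (-(β' / 2) * ‖u‖ ^ 2) ≤ ∫ u : E, (1 + ‖u‖) * exp (-(β / 2) * ‖u‖ ^ 2) :=
  integral_mono (Literature.Analysis.FluidPDE.integrable_one_add_norm_mul_exp (hβ.trans_le h))
    (Literature.Analysis.FluidPDE.integrable_one_add_norm_mul_exp hβ)
    fun u => mul_le_mul_of_nonneg_left (exp_weight_mono h ‖u‖) (by positivity)

/-- `I_β ≥ 0`. [folklore] -/
theorem integral_one_add_norm_mul_exp_nonneg (β : ℝ) :
    0 ≤ ∫ u : E, (1 + ‖u‖) * exp (-(β / 2) * ‖u‖ ^ 2) :=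
  integral_nonneg fun u => by positivity

/-- The `f⁺`-collision frequency `L(f⁺)(v) = ∫∫ ((v - v_*)·ω)_+ f(v_*)⁺ dω dv_* ≥ 0`. [folklore] -/
theorem lossPos_nonneg (f : E → ℝ) (v : E) :
    0 ≤ ∫ w, ∫ ω, hardSphereKernel (v, w) ω * max (f w) 0
      ∂(sphereMeasure : Measure (sphere (0 : E) 1)) :=
  integral_nonneg fun _ => integral_nonneg fun _ =>
    mul_nonneg (hardSphereKernel_nonneg' _ _) (le_max_right _ _)

/-- **One-sided estimate behind positivity** (the sign structure `Q = Q⁺ - f L(f)` of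
Kaniel–Shinbrot, in Lanford's weighted class): for continuous `f` with `|f| ≤ M e^{-β|u|²/2}` and
negative part `f⁻ ≤ N e^{-β|u|²/2}` (`β > 0`),
`-(Q(f,f)(v) + f(v) L(f⁺)(v)) ≤ 3 M N |S^{d-1}| I_β (1 + |v|) e^{-β|v|²/2}`. [folklore] -/
theorem neg_collisionOp_add_mul_lossPos_le {f : E → ℝ} (hfc : Continuous f) {M N β : ℝ}
    (hM : 0 ≤ M) (hN : 0 ≤ N) (hβ : 0 < β)
    (hf : ∀ u, |f u| ≤ M * exp (-(β / 2) * ‖u‖ ^ 2))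
    (hfn : ∀ u, -f u ≤ N * exp (-(β / 2) * ‖u‖ ^ 2)) (v : E) :
    -(collisionOp f f v + f v * ∫ w, ∫ ω, hardSphereKernel (v, w) ω * max (f w) 0
        ∂(sphereMeasure : Measure (sphere (0 : E) 1))) ≤
      3 * M * N * (sphereMeasure : Measure (sphere (0 : E) 1)).real univ *
        (∫ u : E, (1 + ‖u‖) * exp (-(β / 2) * ‖u‖ ^ 2)) *
          ((1 + ‖v‖) * exp (-(β / 2) * ‖v‖ ^ 2)) := by
  haveI := Literature.Analysis.FluidPDE.isFiniteMeasure_sphereMeasure (E := E)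
  set S : ℝ := (sphereMeasure : Measure (sphere (0 : E) 1)).real univ with hS
  set ψ : E → ℝ := fun u => (1 + ‖u‖) * exp (-(β / 2) * ‖u‖ ^ 2) with hψ
  have hψi : Integrable ψ := Literature.Analysis.FluidPDE.integrable_one_add_norm_mul_exp hβ
  -- the two integrands and their continuity
  have hcA := continuous_collisionIntegrand hfc hfc
  have hcD : Continuous (fun q : (E × E) × sphere (0 : E) 1 =>
      f q.1.1 * (hardSphereKernel q.1 q.2 * max (f q.1.2) 0)) := by
    have h1 : Continuous (fun q : (E × E) × sphere (0 : E) 1 => f q.1.1) := hfc.comp (by fun_prop)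
    have h2 : Continuous (fun q : (E × E) × sphere (0 : E) 1 => f q.1.2) := hfc.comp (by fun_prop)
    exact h1.mul (continuous_hardSphereKernel_uncurry.mul (h2.max continuous_const))
  have hpw : Continuous fun q : E × sphere (0 : E) 1 => ((v, q.1), q.2) := by fun_prop
  have hcA' : Continuous (Function.uncurry fun w ω => collisionIntegrand f f (v, w) ω) := hcA.comp hpw
  have hcD' : Continuous (Function.uncurry fun w ω => f v * (hardSphereKernel (v, w) ω * max (f w) 0)) :=
    hcD.comp hpw
  -- pointwise bounds
  have hdA : ∀ w ω, |collisionIntegrand f f (v, w) ω| ≤ (4 * M * M * ψ v) * ψ w := fun w ω => by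
    have h := abs_collisionIntegrand_le hM hf (v, w) ω
    simp only [hψ]; dsimp only at h; linarith
  have hdD : ∀ w ω, |f v * (hardSphereKernel (v, w) ω * max (f w) 0)| ≤ (M * M * ψ v) * ψ w := by
    intro w ω
    have hk0 := hardSphereKernel_nonneg' (v, w) ω
    have hk := hardSphereKernel_le_weight (v, w) ω
    dsimp only at hk
    have hm0 : 0 ≤ max (f w) 0 := le_max_right _ _
    have hm : max (f w) 0 ≤ M * exp (-(β / 2) * ‖w‖ ^ 2) :=
      max_le ((le_abs_self _).trans (hf w)) (mul_nonneg hM (exp_pos _).le)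
    rw [abs_mul, abs_of_nonneg (mul_nonneg hk0 hm0)]
    calc |f v| * (hardSphereKernel (v, w) ω * max (f w) 0)
        ≤ (M * exp (-(β / 2) * ‖v‖ ^ 2)) *
            (((1 + ‖v‖) * (1 + ‖w‖)) * (M * exp (-(β / 2) * ‖w‖ ^ 2))) :=
          mul_le_mul (hf v) (mul_le_mul hk hm hm0 (by positivity)) (mul_nonneg hk0 hm0) (by positivity)
      _ = (M * M * ψ v) * ψ w := by simp only [hψ]; ring
  -- integrability of the slices
  have hIA : Integrable (fun w => ∫ ω, collisionIntegrand f f (v, w) ω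
      ∂(sphereMeasure : Measure (sphere (0 : E) 1))) :=
    integrable_integral_sphere (H := fun w ω => collisionIntegrand f f (v, w) ω) hcA' hψi hdA
  have hID : Integrable (fun w => ∫ ω, f v * (hardSphereKernel (v, w) ω * max (f w) 0)
      ∂(sphereMeasure : Measure (sphere (0 : E) 1))) :=
    integrable_integral_sphere (H := fun w ω => f v * (hardSphereKernel (v, w) ω * max (f w) 0))
      hcD' hψi hdD
  have hsA : ∀ w, Integrable (fun ω => collisionIntegrand f f (v, w) ω)
      (sphereMeasure : Measure (sphere (0 : E) 1)) := fun w => integrable_sphere_slice hcA' w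
  have hsD : ∀ w, Integrable (fun ω => f v * (hardSphereKernel (v, w) ω * max (f w) 0))
      (sphereMeasure : Measure (sphere (0 : E) 1)) := fun w => integrable_sphere_slice hcD' w
  -- combine the two terms into one double integral
  have hmul : f v * (∫ w, ∫ ω, hardSphereKernel (v, w) ω * max (f w) 0
      ∂(sphereMeasure : Measure (sphere (0 : E) 1))) =
        ∫ w, ∫ ω, f v * (hardSphereKernel (v, w) ω * max (f w) 0)
          ∂(sphereMeasure : Measure (sphere (0 : E) 1)) := by
    rw [← integral_const_mul]
    refine integral_congr_ae (Eventually.of_forall fun w => ?_)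
    dsimp only
    rw [← integral_const_mul]
  have hsum : collisionOp f f v + f v * (∫ w, ∫ ω, hardSphereKernel (v, w) ω * max (f w) 0
      ∂(sphereMeasure : Measure (sphere (0 : E) 1))) =
        ∫ w, ∫ ω, (collisionIntegrand f f (v, w) ω + f v * (hardSphereKernel (v, w) ω * max (f w) 0))
          ∂(sphereMeasure : Measure (sphere (0 : E) 1)) := by
    rw [hmul, collisionOp, ← integral_add hIA hID]
    refine integral_congr_ae (Eventually.of_forall fun w => ?_)
    dsimp only
    rw [← integral_add (hsA w) (hsD w)]
  -- pointwise lower bound and integration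
  have hpt : ∀ w ω, -((3 * M * N * ψ v) * ψ w) ≤
      collisionIntegrand f f (v, w) ω + f v * (hardSphereKernel (v, w) ω * max (f w) 0) := by
    intro w ω
    have h := neg_collisionIntegrand_add_mul_le hM hN hf hfn (v, w) ω
    simp only [hψ]; dsimp only at h; linarith
  have hin : ∀ w, -(S * ((3 * M * N * ψ v) * ψ w)) ≤
      ∫ ω, (collisionIntegrand f f (v, w) ω + f v * (hardSphereKernel (v, w) ω * max (f w) 0))
        ∂(sphereMeasure : Measure (sphere (0 : E) 1)) := by
    intro w
    have h : ∫ _ω, (-((3 * M * N * ψ v) * ψ w)) ∂(sphereMeasure : Measure (sphere (0 : E) 1)) ≤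
        ∫ ω, (collisionIntegrand f f (v, w) ω + f v * (hardSphereKernel (v, w) ω * max (f w) 0))
          ∂(sphereMeasure : Measure (sphere (0 : E) 1)) :=
      integral_mono (integrable_const (-((3 * M * N * ψ v) * ψ w))) ((hsA w).add (hsD w))
        (fun ω => hpt w ω)
    rw [integral_const, smul_eq_mul, ← hS] at h
    linarith
  have h2 : Integrable (fun w => ∫ ω, (collisionIntegrand f f (v, w) ω +
      f v * (hardSphereKernel (v, w) ω * max (f w) 0)) ∂(sphereMeasure : Measure (sphere (0 : E) 1))) :=
    (hIA.add hID).congr (Eventually.of_forall fun w => (integral_add (hsA w) (hsD w)).symm)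
  have h1 : Integrable (fun w => -(S * ((3 * M * N * ψ v) * ψ w))) :=
    ((hψi.const_mul (3 * M * N * ψ v)).const_mul S).neg
  have hout := integral_mono h1 h2 hin
  rw [integral_neg, integral_const_mul, integral_const_mul] at hout
  rw [hsum]
  have : S * (3 * M * N * ψ v * ∫ a, ψ a) = 3 * M * N * S * (∫ u, ψ u) * ψ v := by ring
  linarith

end Velocity

end

end UkaiLanford

end Literature.MathematicalPhysics.KineticTheory
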